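import Literature.NumberTheory.EllipticCurves.ModularParamFormalDictionaryProofs
import Literature.NumberTheory.EllipticCurves.ManinConstantAdditivePrimesProofs
import Literature.NumberTheory.EllipticCurves.HondaStrongIsomorphismAllPrimesProofs
import HarnessLib

/-!
# The Manin constant is a `p`-adic unit at EVERY prime of finite height — `p = 2, 3` included
# (the `x,y`-dictionary route; proofs only)

Topic `NumberTheory/EllipticCurves` (theorems only; no definition, no named fact). Sequel of
`ManinConstantGoodPrimesProofs` / `ManinConstantMultiplicativePrimesProofs` /
`ManinConstantAdditivePrimesProofs`, in support of the named fact
`Literature.NumberTheory.EllipticCurves.edixhoven_int_of_neronLattice_eq_smul_periodLattice`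
(Edixhoven 1991, Prop. 2: the Manin constant `c_f` of an optimal curve is an integer). For its data
— a globally minimal `W'/ℚ`, `f ∈ S₂(Γ₀(N))` with `IsNewformOf W' f`, a Néron-type period pair `L'`
of `W'`, and `q ∈ ℚ` with `Λ_{L'} = q Λ_f` exactly — those files prove `‖q‖_p ≤ 1` at every prime
`p ≥ 5`; the restriction `p ≥ 5` at the primes of FINITE height (good or multiplicative reduction)
came only from the transport step, which read the modular parametrisation on the short model
`y² = x³ − (c₄/48)x − c₆/864`, `p`-integral for `p ≥ 5` only. Here that step is replaced by the
`x,y`-dictionary of `ModularParamFormalDictionaryProofs`: the local parameter `t' = −X'/Y'` of `W'`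
itself along the parametrisation is `θ_C(z)` for the change of variables `C • E = W'` over `ℚ`
(`E` the `ℚ`-model `y² = x³ + a₄x + a₆` of `ℂ/Λ_f`), it lies in `Frac ℤ⟦q⟧ ∩ qℚ⟦q⟧`
(`exists_int_frac_formalVariableChange_subst`, because `w_E(z) = −1/Y` does), and
`log_{W'}(t') = u(C) · Σ aₙ(W')qⁿ/n` with `‖u(C)‖_p = ‖q‖_p`. The Weierstrass-preparation lemma
(`padicInt_exists_map_eq_of_subst_eq_map`) then applies to `[d]_{W'}` at `t'` DIRECTLY — no model
of `W'` other than its minimal equation enters — and gives: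

* `padicNorm_le_one_of_neronLattice_eq_smul_periodLattice_of_formalMul_ne_zero'` — **`‖q‖_p ≤ 1`
  at every prime `p` (ANY `p`) such that (i) `[p]˜ ≠ 0` for the reduction of the minimal model and
  (ii) `Σ aₙ(W')Xⁿ/n = log_{W'}(ψ)` for some `ψ ∈ Xℤ_p⟦X⟧` (Honda's strong isomorphism)**;
* `…_of_not_dvd'` — every GOOD prime, `p = 2, 3` included (finite height and Honda 1970, Thm. 9,
  at every good prime: `formalMul_prime_map_toZMod_ne_zero'`,
  `exists_padicInt_formalLog_subst_eq_lSeriesLog'` of `FormalGroupFrobeniusTypeAllPrimesProofs` /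
  `HondaStrongIsomorphismAllPrimesProofs`, lead c17 of crux stmt-ABC-15125);
* `…_of_dvd_of_not_dvd'` — every MULTIPLICATIVE prime, `p = 2, 3` included (Honda at a node and
  `[p]˜ = Xᵖ` or `ĩ(Xᵖ)`: `HondaStrongIsomorphismMultiplicativeProofs`,
  `formalMul_prime_map_toZMod_ne_zero_of_nodal`, which have no parity hypothesis);
* `…_of_not_additive'` — hence every prime that is not additive (`¬ (p ∣ Δ_min ∧ p ∣ c₄)`), and
  with the additive primes `p ≥ 5` (`ManinConstantAdditivePrimesProofs`):
  `padicNorm_le_one_of_neronLattice_eq_smul_periodLattice_of_imp` — **`‖q‖_p ≤ 1` at every prime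
  `p` except possibly an ADDITIVE prime `p ∈ {2, 3}`**;
  `eq_two_or_eq_three_and_additive_of_dvd_den_…` — every prime factor of `den q` is an additive
  prime `p ∈ {2, 3}` of `W'`; and
  `int_of_neronLattice_eq_smul_periodLattice_of_not_additive_two_three` — **`q ∈ ℤ` (Edixhoven's
  conclusion) for every `W'` whose reduction at `2` and at `3` is not additive (`v₂(N) ≤ 1`,
  `v₃(N) ≤ 1`; in particular for every semistable `W'`)** — unconditionally, without Néron models
  or `X₀(N)_ℤ`. What remains of the fact: the additive primes `2` and `3`.

For the strong Weil curve `|q| = c_f`; classically `c_f ∈ ℤ` (Edixhoven) and `p ∤ c_f` whenever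
`v_p(N) ≤ 1` (Mazur 1978; Abbes–Ullmo 1996; summary in Pasten 2024, §10.1, p. 33).

## References

* B. Edixhoven, *On the Manin constants of modular elliptic curves*, in: Arithmetic Algebraic
  Geometry (Texel, 1989), Progr. Math. 89 (1991), 25–39, Prop. 2. [EdixhovenManin1991]
* H. Pasten, *Shimura curves and the abc conjecture*, J. Number Theory (2024), §10.1 (p. 33).
  [PastenShimura2024]
* A. Abbes, E. Ullmo, *À propos de la conjecture de Manin pour les courbes elliptiques modulaires*,
  Compositio Math. 103 (1996), 269–286, Thm. A.
* T. Honda, *On the theory of commutative formal groups*, J. Math. Soc. Japan 22 (1970), 213–246,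
  §6.2 and Thm. 9 (pp. 240–242). [Honda1970]
* J. H. Silverman, *The Arithmetic of Elliptic Curves*, 2nd ed. (2009), III.1, IV.1, IV.7, VII.5.
  [SilvermanAEC2009]
-/

noncomputable section

open scoped Classical

namespace Literature.NumberTheory.EllipticCurves

open PowerSeries Literature.RingTheory.FormalGroups Literature.NumberTheory.EllipticCurves.ModularForms
open Literature.NumberTheory.EllipticCurves.HondaCongruence Literature.NumberTheory.Automorphic
open _root_.WeierstrassCurve
open scoped MatrixGroups ModularForm
open CongruenceSubgroup

/-! ### `‖q‖_p ≤ 1` at ANY prime of finite height with a Honda witness -/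

/-- **The Manin-constant multiplier is a `p`-adic integer at every prime of finite height with a
Honda witness — every `p`, the primes `2` and `3` included.** The data of
`edixhoven_int_of_neronLattice_eq_smul_periodLattice` (`W'/ℚ` globally minimal, `IsNewformOf W' f`,
`Λ_{L'} = q Λ_f` exactly) and a prime `p` such that (i) the reduction mod `p` of the minimal model
has `[p]˜ ≠ 0` and (ii) `Σ aₙ(W')Xⁿ/n = log_{W'}(ψ)` for some `ψ ∈ Xℤ_p⟦X⟧` give `‖q‖_p ≤ 1`.
Proof: steps 1–2 of `ManinConstantGoodPrimesProofs` (the `ℚ`-model `E` of `ℂ/Λ_f`, `C • E = W'`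
with `‖u(C)‖_p = ‖q‖_p`, the series `z` with `log_E(z) = Σ aₙqⁿ/n`); then the parameter
`t' = θ_C(z)` of `W'` (`log_{W'}(t') = u·Σ aₙqⁿ/n`, `[X¹]t' = u`) lies in `Frac ℤ⟦q⟧` by the
`x,y`-dictionary (`exists_rat_series_formalLog_subst_eq_formalW`,
`exists_int_frac_formalVariableChange_subst`); with `u = n₁/d` in lowest terms
`[d]_{W'}(t') = [n₁]_{W'}(ψ) ∈ ℤ_p⟦q⟧`, and the Weierstrass-preparation lemma
`padicInt_exists_map_eq_of_subst_eq_map` for `g = [d]` (finite height) gives `t' ∈ ℤ_p⟦q⟧`, so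
`u = [X¹]t' ∈ ℤ_p`. [cite: EdixhovenManin1991, Prop. 2] [cite: PastenShimura2024, §10.1 (p. 33)]
[cite: Honda1970, Thm. 9 (pp. 240–241)] [cite: SilvermanAEC2009, IV.1] -/
theorem padicNorm_le_one_of_neronLattice_eq_smul_periodLattice_of_formalMul_ne_zero' {N : ℕ} [NeZero N]
    {W' : WeierstrassCurve ℚ} [W'.IsElliptic] [W'.IsGloballyMinimal] {f : CuspForm (Gamma0 N) 2}
    {L' : PeriodPair} (hf : IsNewformOf W' f) (hL' : IsNeronLatticeOf (W'.baseChange ℂ) L')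
    {q : ℚ} (hq : ∀ z ∈ periodLattice f, (q : ℂ) * z ∈ L'.lattice)
    (hq' : ∀ z ∈ L'.lattice, ∃ w ∈ periodLattice f, z = q * w)
    {p : ℕ} [Fact p.Prime]
    (hfin : ((integralModelInt W').map (Int.castRingHom (ZMod p))).formalMul p ≠ 0)
    (hψex : ∃ ψ : ℚ_[p]⟦X⟧, constantCoeff ψ = 0 ∧ (∀ n, ‖coeff n ψ‖ ≤ 1) ∧
      (W'.map (algebraMap ℚ ℚ_[p])).formalLog.subst ψ =
        PowerSeries.mk fun k ↦ ((W'.LFunction k : ℤ) : ℚ_[p]) / k) :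
    ‖(q : ℚ_[p])‖ ≤ 1 := by
  /- Step 1: lattices. `q ≠ 0`, `L := q⁻¹ L'` spans `Λ_f`, the short model `E` of `ℂ/Λ_f`. -/
  have hq0 : q ≠ 0 := by
    rintro rfl
    obtain ⟨w, -, hw⟩ := hq' L'.ω₁ L'.ω₁_mem_lattice
    rw [Rat.cast_zero, zero_mul] at hw
    exact (LinearIndependent.ne_zero 0 L'.indep) (by simpa using hw)
  have hqC : (q : ℂ) ≠ 0 := by exact_mod_cast hq0
  set L : PeriodPair := L'.mulLeft ((q : ℂ)⁻¹) (inv_ne_zero hqC) with hLdef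
  have hL : ∀ x, x ∈ L.lattice ↔ x ∈ periodLattice f := fun x ↦ by
    rw [hLdef, PeriodPair.mem_mulLeft_lattice, inv_inv]
    constructor
    · intro hx
      obtain ⟨w, hw, hxw⟩ := hq' _ hx
      rwa [mul_left_cancel₀ hqC hxw]
    · exact hq x
  have hΛ : L'.lattice = (L.mulLeft (q : ℂ) hqC).lattice := by
    ext z
    rw [PeriodPair.mem_mulLeft_lattice, hL]
    constructor
    · intro hz
      obtain ⟨w, hw, rfl⟩ := hq' z hz
      rwa [← mul_assoc, inv_mul_cancel₀ hqC, one_mul]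
    · intro hz
      have h := hq _ hz
      rwa [← mul_assoc, mul_inv_cancel₀ hqC, one_mul] at h
  have hf0 : f ≠ 0 := hf.1.ne_zero
  have ha : ∀ n, ((W'.LFunction n : ℤ) : ℂ) = cuspCoeff f n := fun n ↦ (hf.2 n).symm
  have hrat : ∀ n, ∃ r : ℚ, (r : ℂ) = cuspCoeff f n := fun n ↦
    ⟨(W'.LFunction n : ℚ), by rw [← ha n, Rat.cast_intCast]⟩
  obtain ⟨⟨q₂, hq₂⟩, ⟨q₃, hq₃⟩⟩ :=
    PeriodPair.ratCast_g₂_g₃_of_lattice_eq_periodLattice f hf0 hrat L hL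
  set a₄ : ℚ := -q₂ / 4 with ha₄
  set a₆ : ℚ := -q₃ / 4 with ha₆
  have h₂ : L.g₂ = -4 * (a₄ : ℂ) := by rw [← hq₂, ha₄]; push_cast; ring
  have h₃ : L.g₃ = -4 * (a₆ : ℂ) := by rw [← hq₃, ha₆]; push_cast; ring
  set E : WeierstrassCurve ℚ := { a₁ := 0, a₂ := 0, a₃ := 0, a₄ := a₄, a₆ := a₆ } with hE
  haveI hEe : E.IsElliptic := isElliptic_shortModel h₂ h₃
  have hEL : IsNeronLatticeOf (E.baseChange ℂ) L := isNeronLatticeOf_shortModel h₂ h₃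
  /- Step 2: the modular parametrisation as a formal series `z ∈ Xℚ⟦X⟧ ∩ Frac ℤ⟦X⟧`, with
  `w_E(z) ∈ Frac ℤ⟦X⟧` as well (the `x,y`-dictionary). -/
  obtain ⟨z, P, Q, P₂, Q₂, hz0, hQ, hPQ, hQ₂, hPQ₂, hlog⟩ := exists_rat_series_formalLog_subst_eq_formalW f hf0
    (W'.LFunction : ℕ → ℤ) ha L (fun x hx ↦ (hL x).mpr hx) a₄ a₆ h₂ h₃
  /- Step 3: `C • E = W'` over `ℚ` with `0 < u(C)` and `‖u(C)‖_p = ‖q‖_p`. -/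
  obtain ⟨e₄, e₆⟩ := hL'.c₄_eq_of_lattice_eq_mulLeft hqC hΛ
  have hc₄E : (E.baseChange ℂ).c₄ = (E.c₄ : ℂ) := by
    simp [WeierstrassCurve.baseChange, WeierstrassCurve.map_c₄]
  have hc₆E : (E.baseChange ℂ).c₆ = (E.c₆ : ℂ) := by
    simp [WeierstrassCurve.baseChange, WeierstrassCurve.map_c₆]
  have h₄ : W'.c₄ = (q ^ 4)⁻¹ * E.c₄ := by
    have h : ((W'.c₄ : ℚ) : ℂ) = (((q ^ 4)⁻¹ * E.c₄ : ℚ) : ℂ) := by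
      rw [e₄, hEL.1, hc₄E]; push_cast; ring
    exact_mod_cast h
  have h₆ : W'.c₆ = (q ^ 6)⁻¹ * E.c₆ := by
    have h : ((W'.c₆ : ℚ) : ℂ) = (((q ^ 6)⁻¹ * E.c₆ : ℚ) : ℂ) := by
      rw [e₆, hEL.2, hc₆E]; push_cast; ring
    exact_mod_cast h
  obtain ⟨vc, hC, hCpos⟩ : ∃ vc : VariableChange ℚ, vc • E = W' ∧ 0 < (vc.u : ℚ) := by
    obtain ⟨vc, hC⟩ := exists_variableChange_of_c₄_eq_of_c₆_eq hq0 h₄ h₆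
    rcases lt_or_gt_of_ne vc.u.ne_zero with hneg | hpos
    · have hE' : (⟨-1, 0, 0, 0⟩ : VariableChange ℚ) • E = E := by
        rw [hE, smul_shortModel, inv_neg_one]
        congr 1 <;> push_cast <;> ring
      refine ⟨vc * ⟨-1, 0, 0, 0⟩, by rw [mul_smul, hE', hC], ?_⟩
      show 0 < ((vc.u * -1 : ℚˣ) : ℚ)
      rw [Units.val_mul, Units.val_neg, Units.val_one]
      linarith
    · exact ⟨vc, hC, hpos⟩
  have hCu0 : (vc.u : ℚ) ≠ 0 := vc.u.ne_zero
  -- `‖u(vc)‖_p = ‖q‖_p`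
  have hnorm : ‖((vc.u : ℚ) : ℚ_[p])‖ = ‖(q : ℚ_[p])‖ := by
    have hW4 : W'.c₄ = ((vc.u : ℚ))⁻¹ ^ 4 * E.c₄ := by
      rw [← hC, variableChange_c₄, Units.val_inv_eq_inv_val]
    have hW6 : W'.c₆ = ((vc.u : ℚ))⁻¹ ^ 6 * E.c₆ := by
      rw [← hC, variableChange_c₆, Units.val_inv_eq_inv_val]
    have hΔ : E.c₄ ≠ 0 ∨ E.c₆ ≠ 0 := by
      by_contra hcon
      rw [not_or, not_not, not_not] at hcon
      have h1728 := E.c_relation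
      rw [hcon.1, hcon.2] at h1728
      exact E.isUnit_Δ.ne_zero (by linear_combination (1 / 1728 : ℚ) * h1728)
    have key : (vc.u : ℚ) ^ 4 = q ^ 4 ∨ (vc.u : ℚ) ^ 6 = q ^ 6 := by
      rcases hΔ with hc | hc
      · left
        have h' := mul_right_cancel₀ hc (hW4.symm.trans h₄)
        rw [inv_pow] at h'
        exact inv_injective h'
      · right
        have h' := mul_right_cancel₀ hc (hW6.symm.trans h₆)
        rw [inv_pow] at h'
        exact inv_injective h'
    rcases key with h | h
    · have h' : ‖((vc.u : ℚ) : ℚ_[p])‖ ^ 4 = ‖(q : ℚ_[p])‖ ^ 4 := by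
        rw [← norm_pow, ← norm_pow, ← Rat.cast_pow, ← Rat.cast_pow, h]
      exact (pow_left_inj₀ (norm_nonneg _) (norm_nonneg _) (by norm_num)).mp h'
    · have h' : ‖((vc.u : ℚ) : ℚ_[p])‖ ^ 6 = ‖(q : ℚ_[p])‖ ^ 6 := by
        rw [← norm_pow, ← norm_pow, ← Rat.cast_pow, ← Rat.cast_pow, h]
      exact (pow_left_inj₀ (norm_nonneg _) (norm_nonneg _) (by norm_num)).mp h'
  rw [← hnorm]
  /- Step 4: the parameter `t₀ = θ_C(z)` of `W'` over `ℚ`: `[X¹]t₀ = u`, `log_{W'}(t₀) = u·ℓ`,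
  and `t₀ ∈ Frac ℤ⟦X⟧` by the dictionary. -/
  have hz1 : coeff 1 z = 1 := by
    have h1 := congrArg (coeff 1) hlog
    rwa [coeff_one_subst_eq_mul _ hz0, coeff_one_formalLog, one_mul, coeff_mk, Nat.cast_one,
      div_one, W'.isMultiplicative_LFunction.map_one, Int.cast_one] at h1
  set t₀ : ℚ⟦X⟧ := (E.formalVariableChange vc).subst z with ht₀
  have ht₀0 : constantCoeff t₀ = 0 :=
    (constantCoeff_subst_eq_constantCoeff hz0).trans (E.constantCoeff_formalVariableChange vc)
  have ht₀1 : coeff 1 t₀ = (vc.u : ℚ) := by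
    rw [ht₀, E.coeff_one_formalVariableChange_subst vc hz0, hz1, mul_one]
  have hlog₀ : W'.formalLog.subst t₀ = C (vc.u : ℚ) * PowerSeries.mk fun n ↦ ((W'.LFunction n : ℤ) : ℚ) / n := by
    rw [ht₀, ← hlog, ← hC]
    exact E.formalLog_subst_formalVariableChange_subst vc hz0
  obtain ⟨P', Q', hQ', hPQ'⟩ := E.exists_int_frac_formalVariableChange_subst vc hz0 hQ hPQ hQ₂ hPQ₂
  rw [← ht₀] at hPQ'
  /- Step 5: base change to `ℚ_p`. -/
  set φ : ℚ →+* ℚ_[p] := algebraMap ℚ ℚ_[p] with hφ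
  set Wp : WeierstrassCurve ℚ_[p] := W'.map φ with hWp
  set ℓ : ℚ_[p]⟦X⟧ := PowerSeries.mk fun k ↦ ((W'.LFunction k : ℤ) : ℚ_[p]) / k with hℓ
  set t' : ℚ_[p]⟦X⟧ := t₀.map φ with ht'
  have ht₀s : HasSubst t₀ := HasSubst.of_constantCoeff_zero' ht₀0
  have ht'0 : constantCoeff t' = 0 := by
    rw [ht', ← coeff_zero_eq_constantCoeff, coeff_map, coeff_zero_eq_constantCoeff, ht₀0, map_zero]
  have ht's : HasSubst t' := HasSubst.of_constantCoeff_zero' ht'0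
  have ht'1 : coeff 1 t' = ((vc.u : ℚ) : ℚ_[p]) := by rw [ht', coeff_map, ht₀1, hφ, eq_ratCast]
  have hℓ' : (PowerSeries.mk fun n ↦ ((W'.LFunction n : ℤ) : ℚ) / n).map φ = ℓ := by
    ext n; rw [coeff_map, coeff_mk, hℓ, coeff_mk, map_div₀, map_natCast, map_intCast]
  have hCu : (C (vc.u : ℚ) : ℚ⟦X⟧).map φ = C ((vc.u : ℚ) : ℚ_[p]) := by
    rw [map_C, eq_ratCast]
  have hlogW : Wp.formalLog.subst t' = C ((vc.u : ℚ) : ℚ_[p]) * ℓ := by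
    rw [ht', hWp, ← W'.map_formalLog φ, ← powerSeries_map_subst ht₀s φ, hlog₀, map_mul, hCu, hℓ']
  set V : WeierstrassCurve ℤ_[p] := (integralModelInt W').map (Int.castRingHom ℤ_[p]) with hV
  have hVc : V.map PadicInt.Coe.ringHom = Wp := map_coe_integralModelInt W'
  have hVt : V.map PadicInt.toZMod = (integralModelInt W').map (Int.castRingHom (ZMod p)) :=
    map_toZMod_integralModelInt W'
  haveI hWpI : Wp.IsIntegral ℤ_[p] := by rw [← hVc]; exact V.isIntegral_map_coe
  have hPV : (V.map PadicInt.toZMod).formalMul p ≠ 0 := by rw [hVt]; exact hfin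
  /- Step 6: Honda — `ℓ = log_{W'}(ψ)` with `ψ ∈ Xℤ_p⟦X⟧`. -/
  obtain ⟨ψ, hψ0, hψi, hψ⟩ := hψex
  have hψ' : Wp.formalLog.subst ψ = ℓ := hψ
  have hψs : HasSubst ψ := HasSubst.of_constantCoeff_zero' hψ0
  have hψI : IsPadicInt ψ := isPadicInt_iff_coeff.mpr hψi
  /- Step 7: `u = n₁ / d` in lowest terms; `[d](t') = [n₁](ψ) =: w ∈ ℤ_p⟦X⟧`. -/
  set d : ℕ := (vc.u : ℚ).den with hd
  have hd0 : 0 < d := (vc.u : ℚ).den_pos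
  have hnum : 0 < (vc.u : ℚ).num := Rat.num_pos.mpr hCpos
  set n₁ : ℕ := (vc.u : ℚ).num.toNat with hn₁
  have hn₁z : ((n₁ : ℕ) : ℤ) = (vc.u : ℚ).num := Int.toNat_of_nonneg hnum.le
  have hdu : (d : ℚ_[p]) * ((vc.u : ℚ) : ℚ_[p]) = (n₁ : ℚ_[p]) := by
    have h : ((vc.u : ℚ)) * d = ((vc.u : ℚ).num : ℚ) := Rat.mul_den_eq_num _
    rw [← hn₁z] at h
    have h' := congrArg (fun r : ℚ ↦ (r : ℚ_[p])) h
    simp only [Rat.cast_mul, Rat.cast_natCast, Int.cast_natCast] at h'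
    rw [mul_comm]
    exact h'
  set w : ℚ_[p]⟦X⟧ := (Wp.formalMul n₁).subst ψ with hw
  have hwI : IsPadicInt w := (Wp.isPadicInt_formalMul n₁).powerSeries_subst hψI hψs
  have hw0 : constantCoeff w = 0 :=
    (constantCoeff_subst_of_constantCoeff_eq_zero hψ0).trans (Wp.constantCoeff_formalMul n₁)
  have hlogw : Wp.formalLog.subst w = n₁ • ℓ := by
    rw [hw, ← subst_comp_subst_apply (Wp.hasSubst_formalMul n₁) hψs, Wp.formalLog_subst_formalMul n₁,
      ← coe_substAlgHom hψs, map_nsmul, coe_substAlgHom, hψ']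
  have hdt'0 : constantCoeff ((Wp.formalMul d).subst t') = 0 :=
    (constantCoeff_subst_of_constantCoeff_eq_zero ht'0).trans (Wp.constantCoeff_formalMul d)
  have hlogd : Wp.formalLog.subst ((Wp.formalMul d).subst t') = n₁ • ℓ := by
    rw [← subst_comp_subst_apply (Wp.hasSubst_formalMul d) ht's, Wp.formalLog_subst_formalMul d,
      ← coe_substAlgHom ht's, map_nsmul, coe_substAlgHom, hlogW, nsmul_eq_mul, nsmul_eq_mul,
      ← mul_assoc, ← map_natCast (C : ℚ_[p] →+* ℚ_[p]⟦X⟧) d, ← map_mul, hdu, map_natCast]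
  have hGw : (Wp.formalMul d).subst t' = w :=
    Wp.eq_of_formalLog_subst_eq hdt'0 hw0 (hlogd.trans hlogw.symm)
  /- Step 8: the Weierstrass-preparation lemma for `g = [d]_V` at `t'`. -/
  have halg : (algebraMap ℤ_[p] ℚ_[p] : ℤ_[p] →+* ℚ_[p]) = PadicInt.Coe.ringHom := rfl
  obtain ⟨w₁, hw₁⟩ := isPadicInt_iff_exists_powerSeries_map.mp hwI
  obtain ⟨dd, hdd, hunit⟩ := V.exists_isUnit_coeff_formalMul_subst_of_formalMul_prime_ne_zero hPV hd0
    (θ := X) constantCoeff_X (by rw [coeff_one_X]; exact isUnit_one)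
  rw [powerSeries_subst_X_self] at hunit
  -- the `Frac ℤ_p⟦X⟧`-witness for `t'`
  set Q₁ : ℤ_[p]⟦X⟧ := Q'.map (Int.castRingHom ℤ_[p]) with hQ₁
  set P₁ : ℤ_[p]⟦X⟧ := P'.map (Int.castRingHom ℤ_[p]) with hP₁
  have hintQ : ∀ R : ℤ⟦X⟧, (R.map (Int.castRingHom ℤ_[p])).map (algebraMap ℤ_[p] ℚ_[p]) =
      (R.map (Int.castRingHom ℚ)).map φ := fun R ↦ by
    ext n
    simp [coeff_map]
  have hQ₁0 : Q₁ ≠ 0 := by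
    intro h0
    apply hQ'
    apply PowerSeries.map_injective (Int.castRingHom ℤ_[p]) Int.cast_injective
    rw [← hQ₁, h0, map_zero]
  have hPQ₁ : t' * Q₁.map (algebraMap ℤ_[p] ℚ_[p]) = P₁.map (algebraMap ℤ_[p] ℚ_[p]) := by
    rw [hQ₁, hP₁, hintQ, hintQ, ht', ← map_mul, hPQ']
  have hGz : (V.formalMul d).subst t' = w₁.map (algebraMap ℤ_[p] ℚ_[p]) := by
    rw [← subst_map_algebraMap (V.formalMul d) ht's, halg, map_formalMul, hVc, hGw, ← hw₁]
  obtain ⟨t₁, ht₁⟩ :=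
    Literature.RingTheory.PowerSeries.padicInt_exists_map_eq_of_subst_eq_map hdd hunit ht'0 hGz
      hQ₁0 hPQ₁
  /- Step 9: `u = [X¹](t') ∈ ℤ_p`. -/
  have h1 : (algebraMap ℤ_[p] ℚ_[p]) (coeff 1 t₁) = ((vc.u : ℚ) : ℚ_[p]) := by
    rw [← ht'1, ← ht₁, coeff_map]
  rw [← h1]
  exact PadicInt.norm_le_one _

/-! ### The good primes, all `p` -/

/-- **`‖q‖_p ≤ 1` at every GOOD prime `p` — `p = 2, 3` included** (the cases missing from
`ManinConstantGoodPrimesProofs`, whose transport needed `p ≥ 5`): finite height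
(`formalMul_prime_map_toZMod_ne_zero'`) and Honda's strong isomorphism
(`exists_padicInt_formalLog_subst_eq_lSeriesLog'`, Honda 1970, Thm. 9) hold at every good prime.
[cite: EdixhovenManin1991, Prop. 2] [cite: PastenShimura2024, §10.1 (p. 33)]
[cite: Honda1970, Thm. 9 (pp. 240–241)] -/
theorem padicNorm_le_one_of_neronLattice_eq_smul_periodLattice_of_not_dvd' {N : ℕ} [NeZero N]
    {W' : WeierstrassCurve ℚ} [W'.IsElliptic] [W'.IsGloballyMinimal] {f : CuspForm (Gamma0 N) 2}
    {L' : PeriodPair} (hf : IsNewformOf W' f) (hL' : IsNeronLatticeOf (W'.baseChange ℂ) L')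
    {q : ℚ} (hq : ∀ z ∈ periodLattice f, (q : ℂ) * z ∈ L'.lattice)
    (hq' : ∀ z ∈ L'.lattice, ∃ w ∈ periodLattice f, z = q * w)
    {p : ℕ} [Fact p.Prime] (hgood : ¬ (p : ℤ) ∣ minimalDiscriminantInt W') :
    ‖(q : ℚ_[p])‖ ≤ 1 := by
  refine padicNorm_le_one_of_neronLattice_eq_smul_periodLattice_of_formalMul_ne_zero' hf hL' hq hq' ?_
    (W'.exists_padicInt_formalLog_subst_eq_lSeriesLog' hgood)
  set V : WeierstrassCurve ℤ_[p] := (integralModelInt W').map (Int.castRingHom ℤ_[p]) with hV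
  have hVc : V.map PadicInt.Coe.ringHom = W'.map (algebraMap ℚ ℚ_[p]) := map_coe_integralModelInt W'
  have hVt : V.map PadicInt.toZMod = (integralModelInt W').map (Int.castRingHom (ZMod p)) :=
    map_toZMod_integralModelInt W'
  haveI hEc : (V.map PadicInt.Coe.ringHom).IsElliptic := by rw [hVc]; infer_instance
  haveI hEt' := isElliptic_reduction_of_not_dvd (p := p) W' hgood
  haveI hEt : (V.map PadicInt.toZMod).IsElliptic := by rw [hVt]; infer_instance
  have h := V.formalMul_prime_map_toZMod_ne_zero'
  rwa [hVt] at h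

/-! ### The multiplicative primes, all `p` -/

/-- **`‖q‖_p ≤ 1` at every multiplicative prime `p` — `p = 2, 3` included** (`p ∣ Δ_min(W')`,
`p ∤ c₄(W')`): Honda at a node (`exists_padicInt_formalLog_subst_eq_lSeriesLog_of_dvd_of_not_dvd`)
and `[p]˜ ≠ 0` at a node (`formalMul_prime_map_toZMod_ne_zero_of_nodal`) hold for every `p`.
[cite: EdixhovenManin1991, Prop. 2] [cite: PastenShimura2024, §10.1 (p. 33)]
[cite: Honda1970, Thm. 9 (pp. 240–241)] -/
theorem padicNorm_le_one_of_neronLattice_eq_smul_periodLattice_of_dvd_of_not_dvd' {N : ℕ} [NeZero N]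
    {W' : WeierstrassCurve ℚ} [W'.IsElliptic] [W'.IsGloballyMinimal] {f : CuspForm (Gamma0 N) 2}
    {L' : PeriodPair} (hf : IsNewformOf W' f) (hL' : IsNeronLatticeOf (W'.baseChange ℂ) L')
    {q : ℚ} (hq : ∀ z ∈ periodLattice f, (q : ℂ) * z ∈ L'.lattice)
    (hq' : ∀ z ∈ L'.lattice, ∃ w ∈ periodLattice f, z = q * w)
    {p : ℕ} [Fact p.Prime] (hΔ : (p : ℤ) ∣ minimalDiscriminantInt W')
    (hc₄ : ¬ (p : ℤ) ∣ (integralModelInt W').c₄) : ‖(q : ℚ_[p])‖ ≤ 1 := by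
  refine padicNorm_le_one_of_neronLattice_eq_smul_periodLattice_of_formalMul_ne_zero' hf hL' hq hq'
    ?_ (W'.exists_padicInt_formalLog_subst_eq_lSeriesLog_of_dvd_of_not_dvd hΔ hc₄)
  have h := ((integralModelInt W').map (Int.castRingHom ℤ_[p])).formalMul_prime_map_toZMod_ne_zero_of_nodal
    ?_ ?_
  · rwa [map_toZMod_integralModelInt] at h
  · rw [map_toZMod_integralModelInt, map_Δ, eq_intCast, ZMod.intCast_zmod_eq_zero_iff_dvd]
    exact hΔ
  · rw [map_toZMod_integralModelInt, map_c₄, eq_intCast, Ne, ZMod.intCast_zmod_eq_zero_iff_dvd]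
    exact hc₄

/-- **`‖q‖_p ≤ 1` at every prime `p` that is not additive** (`¬ (p ∣ Δ_min(W') ∧ p ∣ c₄(W'))`:
good or multiplicative reduction, Silverman VII.5.1), every `p`. [cite: EdixhovenManin1991, Prop. 2]
[cite: PastenShimura2024, §10.1 (p. 33)] -/
theorem padicNorm_le_one_of_neronLattice_eq_smul_periodLattice_of_not_additive' {N : ℕ} [NeZero N]
    {W' : WeierstrassCurve ℚ} [W'.IsElliptic] [W'.IsGloballyMinimal] {f : CuspForm (Gamma0 N) 2}
    {L' : PeriodPair} (hf : IsNewformOf W' f) (hL' : IsNeronLatticeOf (W'.baseChange ℂ) L')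
    {q : ℚ} (hq : ∀ z ∈ periodLattice f, (q : ℂ) * z ∈ L'.lattice)
    (hq' : ∀ z ∈ L'.lattice, ∃ w ∈ periodLattice f, z = q * w)
    {p : ℕ} [Fact p.Prime]
    (hadd : ¬ ((p : ℤ) ∣ minimalDiscriminantInt W' ∧ (p : ℤ) ∣ (integralModelInt W').c₄)) :
    ‖(q : ℚ_[p])‖ ≤ 1 := by
  by_cases hΔ : (p : ℤ) ∣ minimalDiscriminantInt W'
  · exact padicNorm_le_one_of_neronLattice_eq_smul_periodLattice_of_dvd_of_not_dvd' hf hL' hq hq' hΔ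
      fun hc ↦ hadd ⟨hΔ, hc⟩
  · exact padicNorm_le_one_of_neronLattice_eq_smul_periodLattice_of_not_dvd' hf hL' hq hq' hΔ

/-! ### All primes together -/

/-- **`‖q‖_p ≤ 1` at every prime `p`, except possibly at an additive prime `p ∈ {2, 3}`**
(non-additive `p`: above; additive `p ≥ 5`: `ManinConstantAdditivePrimesProofs`).
[cite: EdixhovenManin1991, Prop. 2] [cite: PastenShimura2024, §10.1 (p. 33)] -/
theorem padicNorm_le_one_of_neronLattice_eq_smul_periodLattice_of_imp {N : ℕ} [NeZero N]
    {W' : WeierstrassCurve ℚ} [W'.IsElliptic] [W'.IsGloballyMinimal] {f : CuspForm (Gamma0 N) 2}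
    {L' : PeriodPair} (hf : IsNewformOf W' f) (hL' : IsNeronLatticeOf (W'.baseChange ℂ) L')
    {q : ℚ} (hq : ∀ z ∈ periodLattice f, (q : ℂ) * z ∈ L'.lattice)
    (hq' : ∀ z ∈ L'.lattice, ∃ w ∈ periodLattice f, z = q * w)
    {p : ℕ} [Fact p.Prime]
    (h23 : (p : ℤ) ∣ minimalDiscriminantInt W' → (p : ℤ) ∣ (integralModelInt W').c₄ → 5 ≤ p) :
    ‖(q : ℚ_[p])‖ ≤ 1 := by
  by_cases hadd : (p : ℤ) ∣ minimalDiscriminantInt W' ∧ (p : ℤ) ∣ (integralModelInt W').c₄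
  · exact padicNorm_le_one_of_neronLattice_eq_smul_periodLattice_of_dvd_of_dvd hf hL' hq hq'
      (h23 hadd.1 hadd.2) hadd.1 hadd.2
  · exact padicNorm_le_one_of_neronLattice_eq_smul_periodLattice_of_not_additive' hf hL' hq hq' hadd

/-- **Every prime factor of `den q` is an ADDITIVE prime `p ∈ {2, 3}` of `W'`** (`p ∣ Δ_min(W')`
and `p ∣ c₄(W')`, and `p < 5`). [cite: EdixhovenManin1991, Prop. 2] [cite: PastenShimura2024, §10.1 (p. 33)] -/
theorem lt_five_and_additive_of_dvd_den_of_neronLattice_eq_smul_periodLattice {N : ℕ} [NeZero N]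
    {W' : WeierstrassCurve ℚ} [W'.IsElliptic] [W'.IsGloballyMinimal] {f : CuspForm (Gamma0 N) 2}
    {L' : PeriodPair} (hf : IsNewformOf W' f) (hL' : IsNeronLatticeOf (W'.baseChange ℂ) L')
    {q : ℚ} (hq : ∀ z ∈ periodLattice f, (q : ℂ) * z ∈ L'.lattice)
    (hq' : ∀ z ∈ L'.lattice, ∃ w ∈ periodLattice f, z = q * w)
    {p : ℕ} (hp : p.Prime) (hpq : p ∣ q.den) :
    p < 5 ∧ (p : ℤ) ∣ minimalDiscriminantInt W' ∧ (p : ℤ) ∣ (integralModelInt W').c₄ := by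
  haveI := Fact.mk hp
  by_contra hcon
  have hle : ‖(q : ℚ_[p])‖ ≤ 1 := by
    refine padicNorm_le_one_of_neronLattice_eq_smul_periodLattice_of_imp hf hL' hq hq' fun hΔ hc₄ ↦ ?_
    by_contra hlt
    exact hcon ⟨not_le.mp hlt, hΔ, hc₄⟩
  -- `‖q‖_p ≤ 1` contradicts `p ∣ den q`
  have hlt : 1 < ‖(q : ℚ_[p])‖ := by
    have hqden : ‖((q.den : ℤ) : ℚ_[p])‖ < 1 :=
      Padic.norm_intCast_lt_one_iff.mpr (Int.natCast_dvd_natCast.mpr hpq)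
    have hnum : ‖((q.num : ℤ) : ℚ_[p])‖ = 1 := by
      refine le_antisymm (Padic.norm_int_le_one _) (not_lt.mp fun h ↦ ?_)
      have hpn : p ∣ q.num.natAbs := Int.natCast_dvd.mp (Padic.norm_intCast_lt_one_iff.mp h)
      have h1 : p ∣ 1 := by
        have h' := Nat.dvd_gcd hpn hpq
        rwa [Nat.Coprime.gcd_eq_one q.reduced] at h'
      exact hp.ne_one (Nat.dvd_one.mp h1)
    have hq' : (q : ℚ_[p]) = ((q.num : ℤ) : ℚ_[p]) / ((q.den : ℤ) : ℚ_[p]) := by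
      rw [Int.cast_natCast, ← Rat.cast_intCast, ← Rat.cast_natCast, ← Rat.cast_div, Rat.num_div_den]
    have hden0 : 0 < ‖((q.den : ℤ) : ℚ_[p])‖ := by
      rw [norm_pos_iff, Int.cast_natCast, Nat.cast_ne_zero]
      exact q.den_nz
    rw [hq', norm_div, hnum, one_div, one_lt_inv₀ hden0]
    exact hqden
  exact absurd hle (not_le.mpr hlt)

/-- The same, spelled out: a prime factor of `den q` is `2` or `3`, and an additive prime of `W'`.
[cite: EdixhovenManin1991, Prop. 2] -/
theorem eq_two_or_eq_three_and_additive_of_dvd_den_of_neronLattice_eq_smul_periodLattice {N : ℕ}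
    [NeZero N]
    {W' : WeierstrassCurve ℚ} [W'.IsElliptic] [W'.IsGloballyMinimal] {f : CuspForm (Gamma0 N) 2}
    {L' : PeriodPair} (hf : IsNewformOf W' f) (hL' : IsNeronLatticeOf (W'.baseChange ℂ) L')
    {q : ℚ} (hq : ∀ z ∈ periodLattice f, (q : ℂ) * z ∈ L'.lattice)
    (hq' : ∀ z ∈ L'.lattice, ∃ w ∈ periodLattice f, z = q * w)
    {p : ℕ} (hp : p.Prime) (hpq : p ∣ q.den) :
    (p = 2 ∨ p = 3) ∧ (p : ℤ) ∣ minimalDiscriminantInt W' ∧ (p : ℤ) ∣ (integralModelInt W').c₄ := by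
  obtain ⟨h5, hΔ, hc₄⟩ :=
    lt_five_and_additive_of_dvd_den_of_neronLattice_eq_smul_periodLattice hf hL' hq hq' hp hpq
  refine ⟨?_, hΔ, hc₄⟩
  have h2 := hp.two_le
  interval_cases p
  · exact Or.inl rfl
  · exact Or.inr rfl
  · exact absurd hp (by decide)

/-- **Edixhoven's conclusion `q ∈ ℤ` for every `W'` whose reduction at `2` and at `3` is not
additive** (`v₂(N) ≤ 1` and `v₃(N) ≤ 1`; in particular for every semistable `W'`): for such curves
no prime divides `den q`. For the strong Weil curve: `c_f ∈ ℤ` — here unconditionally, by the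
formal group of `W'` alone (classically: Edixhoven 1991, Prop. 2, via Néron models and `X₀(N)_ℤ`;
and then `c_f` is even a unit at every `p` with `v_p(N) ≤ 1`, Mazur / Abbes–Ullmo).
[cite: EdixhovenManin1991, Prop. 2] [cite: PastenShimura2024, §10.1 (p. 33)] -/
theorem int_of_neronLattice_eq_smul_periodLattice_of_not_additive_two_three {N : ℕ} [NeZero N]
    {W' : WeierstrassCurve ℚ} [W'.IsElliptic] [W'.IsGloballyMinimal] {f : CuspForm (Gamma0 N) 2}
    {L' : PeriodPair} (hf : IsNewformOf W' f) (hL' : IsNeronLatticeOf (W'.baseChange ℂ) L')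
    {q : ℚ} (hq : ∀ z ∈ periodLattice f, (q : ℂ) * z ∈ L'.lattice)
    (hq' : ∀ z ∈ L'.lattice, ∃ w ∈ periodLattice f, z = q * w)
    (h2 : ¬ ((2 : ℤ) ∣ minimalDiscriminantInt W' ∧ (2 : ℤ) ∣ (integralModelInt W').c₄))
    (h3 : ¬ ((3 : ℤ) ∣ minimalDiscriminantInt W' ∧ (3 : ℤ) ∣ (integralModelInt W').c₄)) :
    ∃ k : ℤ, (k : ℚ) = q := by
  -- `den q = 1`
  have hden : q.den = 1 := by
    by_contra hne
    obtain ⟨p, hp, hpq⟩ := Nat.exists_prime_and_dvd hne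
    obtain ⟨h23, hΔ, hc₄⟩ :=
      eq_two_or_eq_three_and_additive_of_dvd_den_of_neronLattice_eq_smul_periodLattice hf hL' hq hq' hp hpq
    rcases h23 with rfl | rfl
    · exact h2 ⟨by exact_mod_cast hΔ, by exact_mod_cast hc₄⟩
    · exact h3 ⟨by exact_mod_cast hΔ, by exact_mod_cast hc₄⟩
  exact ⟨q.num, Rat.coe_int_num_of_den_eq_one hden⟩

/-- **In particular `q ∈ ℤ` for every semistable `W'`** (no additive prime at all: square-free
conductor). [cite: EdixhovenManin1991, Prop. 2] -/
theorem int_of_neronLattice_eq_smul_periodLattice_of_semistable {N : ℕ} [NeZero N]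
    {W' : WeierstrassCurve ℚ} [W'.IsElliptic] [W'.IsGloballyMinimal] {f : CuspForm (Gamma0 N) 2}
    {L' : PeriodPair} (hf : IsNewformOf W' f) (hL' : IsNeronLatticeOf (W'.baseChange ℂ) L')
    {q : ℚ} (hq : ∀ z ∈ periodLattice f, (q : ℂ) * z ∈ L'.lattice)
    (hq' : ∀ z ∈ L'.lattice, ∃ w ∈ periodLattice f, z = q * w)
    (hss : ∀ ℓ : ℕ, ℓ.Prime → (ℓ : ℤ) ∣ minimalDiscriminantInt W' → ¬ (ℓ : ℤ) ∣ (integralModelInt W').c₄) :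
    ∃ k : ℤ, (k : ℚ) = q :=
  int_of_neronLattice_eq_smul_periodLattice_of_not_additive_two_three hf hL' hq hq'
    (fun h ↦ hss 2 Nat.prime_two (by exact_mod_cast h.1) (by exact_mod_cast h.2))
    (fun h ↦ hss 3 Nat.prime_three (by exact_mod_cast h.1) (by exact_mod_cast h.2))

end Literature.NumberTheory.EllipticCurves
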